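import Literature.AlgebraicGeometry.Resolution.HironakaDirectrixPolar
import Literature.AlgebraicGeometry.Resolution.HironakaDirectrixLemmas
import Literature.AlgebraicGeometry.Resolution.HironakaDirectrixVars
import Literature.AlgebraicGeometry.Resolution.WeightedCentreHasseDirectrixBridge
import Mathlib.Algebra.MvPolynomial.PDeriv
import Mathlib.Algebra.Polynomial.Derivative
import HarnessLib

/-!
# The polar bound for Hironaka's `τ` is an equality in tame degree (`char k = 0` or `char k > deg F`)

Topic: `Literature/AlgebraicGeometry/Resolution`. Sequel of `HironakaDirectrixPolar.lean`, whose docstring records: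
"`dim_k ⟨∂F/∂Y₁, …, ∂F/∂Y_d⟩ ≤ τ({F})` in every characteristic (with equality when `char k = 0` or `char k > deg F`,
not proved here …)". This file PROVES that equality, and its sharpness at `deg F = char k`:

> **Berthomieu–Hivert–Mourtada 2010, §3.2 / Algorithm 3.5** (case `char k = 0`): "to compute the ridge (which is also
> the directrix by Section 1) … the `𝒟_A^X`'s are the usual differential operators"; **Lemma 3.6**: the ridge is
> generated by the Hasse derivatives of `p`-power degree — for `deg F < p` these are the LINEAR ones, i.e. the
> directrix of a tame form is read off first-order data. **Hironaka 1970, §1–2**: translations leaving a form invariant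
> and differential operators.

* `derivative_dirShift` — chain rule `d/dT H(x + Tv) = (Σ_i v_i ∂_i H)(x + Tv)`; `hasseD_polar_eq`:
  `D_v^{(j)}(∂_v H) = (j+1) D_v^{(j+1)} H`.
* `hasseD_eq_zero_of_polar_eq_zero'` — `∂_v H = 0` and `1, …, deg H` non-zero in the field ⟹ all `D_v^{(j)} H = 0`.
* **`invarianceSpace_singleton_eq_ker_polar`** — `𝕎({F}) = ker (w ↦ Σ_i w_i ∂_i F)` whenever `1, …, deg F ≠ 0` in `k`;
  **`hironakaTau_singleton_eq_finrank_span_pderiv`** — `τ({F}) = dim_k ⟨∂F/∂Y_i⟩` (EQUALITY in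
  `finrank_span_pderiv_le_hironakaTau`); versions `…_of_totalDegree_lt_char`, `…_of_charZero`; sets of polynomials
  `invarianceSpace_eq_iInf_ker_polar`.
* Sharpness at `deg F = p`: `hironakaTau_X_zero_pow_char` (`τ(Y_0^p) = 1`) versus `finrank_span_pderiv_X_zero_pow_char`
  (`= 0`).

First landed summit-side (cell res-hironaka, `Summit.…Theorems.CampaignW46.TamePolar`, p481074); ported here to close the
gap recorded in this topic. AI-written; AI review is weaker than expert review.

## References

* J. Berthomieu, P. Hivert, H. Mourtada, Contemp. Math. 521 (2010), §3.2, Algorithm 3.5, Lemma 3.6.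
  [BerthomieuHivertMourtada2010]
* H. Hironaka, Ann. of Math. 92 (1970), §1–2. [Hironaka1970AdditiveGroups]
* V. Cossart, O. Piltant, J. Algebra 320 (2008), proof of Prop. 4.2 (`τ`, the directrix). [CossartPiltant2008]
-/

noncomputable section

open MvPolynomial
open Literature.AlgebraicGeometry.Resolution.WeightedBlowup.HasseDir

open scoped BigOperators

namespace Literature.AlgebraicGeometry.Resolution

universe u

/-! ## The chain rule for the directional shift `H ↦ H(x + Tv)` (any commutative ring) -/

section ChainRule

variable {σ : Type*} [Fintype σ] {R : Type*} [CommRing R]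

/-- **Chain rule** `d/dT H(x + Tv) = (Σ_i v_i ∂_i H)(x + Tv)`: the `T`-derivative of the directional shift is the
directional shift of the polar `∂_v H` (derived here). [cite: Hironaka1970AdditiveGroups, §1] -/
theorem derivative_dirShift (v : σ → R) (H : MvPolynomial σ R) :
    Polynomial.derivative (dirShift v H) = dirShift v (∑ i, C (v i) * pderiv i H) := by
  classical
  induction H using MvPolynomial.induction_on with
  | C a =>
    simp only [dirShift_C, Polynomial.derivative_C, pderiv_C, mul_zero, Finset.sum_const_zero, map_zero]
  | add p q hp hq =>
    simp only [map_add, hp, hq, mul_add, Finset.sum_add_distrib]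
  | mul_X p i hp =>
    have hδ : ∀ j : σ, pderiv j (X i : MvPolynomial σ R) = if j = i then 1 else 0 := fun j => by
      rw [pderiv_X]; simp [Pi.single_apply, eq_comm]
    have hsum : (∑ j, C (v j) * pderiv j (p * X i)) = (∑ j, C (v j) * pderiv j p) * X i + C (v i) * p := by
      simp only [pderiv_mul, hδ, mul_add, mul_ite, mul_one, mul_zero, Finset.sum_add_distrib,
        Finset.sum_ite_eq', Finset.mem_univ, if_true, Finset.sum_mul]
      congr 1
      exact Finset.sum_congr rfl fun j _ => by ring
    rw [hsum]
    simp only [map_add, map_mul, dirShift_X, dirShift_C, Polynomial.derivative_mul, Polynomial.derivative_C,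
      Polynomial.derivative_X, mul_one, hp]
    ring

/-- **Hasse derivatives of the polar**: `D_v^{(j)} (∂_v H) = (j + 1) · D_v^{(j+1)} H` (the coefficient of `T^j` in the
chain rule; derived here). [cite: Hironaka1970AdditiveGroups, §1] -/
theorem hasseD_polar_eq (v : σ → R) (j : ℕ) (H : MvPolynomial σ R) :
    hasseD v j (∑ i, C (v i) * pderiv i H) = hasseD v (j + 1) H * (j + 1) := by
  rw [hasseD_def, ← derivative_dirShift, Polynomial.coeff_derivative, hasseD_def]

end ChainRule

/-! ## A vanishing polar kills every positive-order Hasse derivative (tame degrees, over a field) -/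

section Field

variable {σ : Type*} [Fintype σ] {k : Type*} [Field k]

/-- **Tame degrees**: if the polar `∂_v H = Σ_i v_i ∂_i H` vanishes and `1, …, deg H` are non-zero in `k` (characteristic
`0`, or `p > deg H`), then `D_v^{(j)} H = 0` for every `j ≥ 1` (derived here; BHM §3.2: in tame degree the Hasse
operators are the usual ones up to units). [cite: BerthomieuHivertMourtada2010, §3.2] -/
theorem hasseD_eq_zero_of_polar_eq_zero' (v : σ → k) {H : MvPolynomial σ k}
    (hchar : ∀ m : ℕ, 1 ≤ m → m ≤ H.totalDegree → (m : k) ≠ 0)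
    (hpol : ∑ i, C (v i) * pderiv i H = 0) : ∀ j : ℕ, 1 ≤ j → hasseD v j H = 0 := by
  intro j hj
  rcases Nat.lt_or_ge H.totalDegree j with hlt | hle
  · exact hasseD_eq_zero_of_totalDegree_lt v H hlt
  · obtain ⟨j', rfl⟩ : ∃ j', j = j' + 1 := ⟨j - 1, by omega⟩
    have h := hasseD_polar_eq v j' H
    rw [hpol, hasseD_zero_right] at h
    have hne : ((j' : MvPolynomial σ k) + 1) ≠ 0 := by
      rw [← Nat.cast_succ, ← map_natCast (C : k →+* MvPolynomial σ k), Ne, C_eq_zero]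
      exact hchar (j' + 1) (by omega) hle
    exact (mul_eq_zero.mp h.symm).resolve_right hne

/-- The hypothesis «`1, …, N` non-zero in `k`» in characteristic `p > N`. [folklore] -/
private theorem natCast_ne_zero_of_lt_char' (p : ℕ) [CharP k p] {N : ℕ} (hN : N < p) :
    ∀ m : ℕ, 1 ≤ m → m ≤ N → (m : k) ≠ 0 := by
  intro m h1 hm
  rw [Ne, CharP.cast_eq_zero_iff k p m]
  exact fun hdvd => absurd (Nat.le_of_dvd (by omega) hdvd) (by omega)

/-- The hypothesis «`1, …, N` non-zero in `k`» in characteristic `0`. [folklore] -/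
private theorem natCast_ne_zero_of_charZero' [CharZero k] (N : ℕ) :
    ∀ m : ℕ, 1 ≤ m → m ≤ N → (m : k) ≠ 0 := by
  intro m h1 _
  exact Nat.cast_ne_zero.mpr (by omega)

end Field

/-! ## The tame directrix is first-order: `𝕎({F}) = ker (w ↦ ∂_w F)` and `τ({F}) = dim ⟨∂_i F⟩` -/

section Directrix

variable (k : Type u) [Field k] {d : ℕ}

/-- **Tame degrees: a vanishing polar gives translation invariance**: if `Σ_i w_i ∂F/∂Y_i = 0` and `1, …, deg F` are
non-zero in `k`, then `w ∈ 𝕎({F})`; the converse is `sum_C_mul_pderiv_eq_zero_of_mem_invarianceSpace` (every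
characteristic). [cite: Hironaka1970AdditiveGroups, §1–2] [cite: BerthomieuHivertMourtada2010, Algorithm 3.5] -/
theorem mem_invarianceSpace_singleton_of_polar_eq_zero {F : MvPolynomial (Fin d) k}
    (hchar : ∀ m : ℕ, 1 ≤ m → m ≤ F.totalDegree → (m : k) ≠ 0) {w : Fin d → k}
    (hw : ∑ i, C (w i) * pderiv i F = 0) :
    w ∈ invarianceSpace k ({F} : Set (MvPolynomial (Fin d) k)) := by
  rw [mem_invarianceSpace_iff_hasseD]
  intro G hG j hj
  rw [Set.mem_singleton_iff] at hG
  subst hG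
  exact hasseD_eq_zero_of_polar_eq_zero' w hchar hw j hj

/-- **The tame directrix is first-order**: for `F ∈ k[Y_1, …, Y_d]` with `1, …, deg F` non-zero in `k` (characteristic
`0`, or `p > deg F`), Hironaka's invariance space is the kernel of the polar map, `𝕎({F}) = {w | Σ_i w_i ∂F/∂Y_i = 0}`
— the equality announced in `HironakaDirectrixPolar` («with equality when `char k = 0` or `char k > deg F`»); it fails at
`deg F = p` (`hironakaTau_X_zero_pow_char` vs `finrank_span_pderiv_X_zero_pow_char`).
[cite: BerthomieuHivertMourtada2010, Algorithm 3.5 and Lemma 3.6] [cite: Hironaka1970AdditiveGroups, §1–2] -/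
theorem invarianceSpace_singleton_eq_ker_polar (F : MvPolynomial (Fin d) k)
    (hchar : ∀ m : ℕ, 1 ≤ m → m ≤ F.totalDegree → (m : k) ≠ 0) :
    invarianceSpace k ({F} : Set (MvPolynomial (Fin d) k)) =
      LinearMap.ker (Fintype.linearCombination k fun i : Fin d => pderiv i F) := by
  refine le_antisymm (invarianceSpace_le_ker_polar k F) fun w hw => ?_
  rw [LinearMap.mem_ker, Fintype.linearCombination_apply] at hw
  refine mem_invarianceSpace_singleton_of_polar_eq_zero k hchar ?_
  simpa [MvPolynomial.smul_eq_C_mul] using hw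

/-- **`τ({F}) = dim_k ⟨∂F/∂Y_1, …, ∂F/∂Y_d⟩` in the tame degrees** (`1, …, deg F` non-zero in `k`): EQUALITY in the polar
bound `finrank_span_pderiv_le_hironakaTau`. [cite: CossartPiltant2008, proof of Prop. 4.2 (τ := dim T)]
[cite: BerthomieuHivertMourtada2010, Algorithm 3.5] -/
theorem hironakaTau_singleton_eq_finrank_span_pderiv (F : MvPolynomial (Fin d) k)
    (hchar : ∀ m : ℕ, 1 ≤ m → m ≤ F.totalDegree → (m : k) ≠ 0) :
    hironakaTau k ({F} : Set (MvPolynomial (Fin d) k)) =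
      Module.finrank k (Submodule.span k (Set.range fun i : Fin d => pderiv i F)) := by
  set f := Fintype.linearCombination k fun i : Fin d => pderiv i F with hf
  have hrange : LinearMap.range f = Submodule.span k (Set.range fun i : Fin d => pderiv i F) :=
    Fintype.range_linearCombination k _
  have hrn := LinearMap.finrank_range_add_finrank_ker f
  rw [Module.finrank_fin_fun] at hrn
  have hker : Module.finrank k (invarianceSpace k ({F} : Set (MvPolynomial (Fin d) k))) =
      Module.finrank k (LinearMap.ker f) := by
    rw [invarianceSpace_singleton_eq_ker_polar k F hchar]
  have hτ := hironakaTau_add_finrank_invarianceSpace k ({F} : Set (MvPolynomial (Fin d) k))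
  rw [← hrange]
  omega

/-- The same for a SET of polynomials, each of tame degree: `𝕎(S) = ⋂_{F ∈ S} ker (w ↦ ∂_w F)`.
[cite: CossartPiltant2008, proof of Prop. 4.2] [cite: BerthomieuHivertMourtada2010, Algorithm 3.5] -/
theorem invarianceSpace_eq_iInf_ker_polar (S : Set (MvPolynomial (Fin d) k))
    (hchar : ∀ F ∈ S, ∀ m : ℕ, 1 ≤ m → m ≤ F.totalDegree → (m : k) ≠ 0) :
    invarianceSpace k S = ⨅ F ∈ S, LinearMap.ker (Fintype.linearCombination k fun i : Fin d => pderiv i F) := by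
  apply le_antisymm
  · intro w hw
    simp only [Submodule.mem_iInf]
    intro F hF
    exact invarianceSpace_le_ker_polar k F (invarianceSpace_antitone k (Set.singleton_subset_iff.mpr hF) hw)
  · intro w hw
    simp only [Submodule.mem_iInf] at hw
    rw [mem_invarianceSpace_iff]
    intro F hF
    have hpol : ∑ i, C (w i) * pderiv i F = 0 := by
      have h := hw F hF
      rw [LinearMap.mem_ker, Fintype.linearCombination_apply] at h
      simpa [MvPolynomial.smul_eq_C_mul] using h
    exact (mem_invarianceSpace_iff k).1 (mem_invarianceSpace_singleton_of_polar_eq_zero k (hchar F hF) hpol) F rfl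

/-- **Characteristic `p > deg F`**: `𝕎({F}) = ker (w ↦ ∂_w F)`. [cite: BerthomieuHivertMourtada2010, Lemma 3.6] -/
theorem invarianceSpace_singleton_eq_ker_polar_of_totalDegree_lt_char (p : ℕ) [CharP k p]
    (F : MvPolynomial (Fin d) k) (hF : F.totalDegree < p) :
    invarianceSpace k ({F} : Set (MvPolynomial (Fin d) k)) =
      LinearMap.ker (Fintype.linearCombination k fun i : Fin d => pderiv i F) :=
  invarianceSpace_singleton_eq_ker_polar k F (natCast_ne_zero_of_lt_char' p hF)

/-- **Characteristic `p > deg F`**: `τ({F}) = dim_k ⟨∂F/∂Y_i⟩`. [cite: BerthomieuHivertMourtada2010, Lemma 3.6] -/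
theorem hironakaTau_singleton_eq_finrank_span_pderiv_of_totalDegree_lt_char (p : ℕ) [CharP k p]
    (F : MvPolynomial (Fin d) k) (hF : F.totalDegree < p) :
    hironakaTau k ({F} : Set (MvPolynomial (Fin d) k)) =
      Module.finrank k (Submodule.span k (Set.range fun i : Fin d => pderiv i F)) :=
  hironakaTau_singleton_eq_finrank_span_pderiv k F (natCast_ne_zero_of_lt_char' p hF)

/-- **Characteristic `0`**: `τ({F}) = dim_k ⟨∂F/∂Y_i⟩` for every `F`. [cite: BerthomieuHivertMourtada2010, Algorithm 3.5] -/
theorem hironakaTau_singleton_eq_finrank_span_pderiv_of_charZero [CharZero k] (F : MvPolynomial (Fin d) k) :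
    hironakaTau k ({F} : Set (MvPolynomial (Fin d) k)) =
      Module.finrank k (Submodule.span k (Set.range fun i : Fin d => pderiv i F)) :=
  hironakaTau_singleton_eq_finrank_span_pderiv k F (natCast_ne_zero_of_charZero' F.totalDegree)

end Directrix

/-! ## Sharpness at `deg F = p`: the form `Y_0^p` -/

section Sharp

variable (k : Type u) [Field k] (p : ℕ) [Fact p.Prime] [CharP k p] {d : ℕ}

omit [Fact p.Prime] in
/-- In characteristic `p` every partial derivative of `Y_0^p ∈ k[Y_0, …, Y_d]` vanishes. [folklore] -/
private theorem pderiv_X_zero_pow_char' (i : Fin (d + 1)) :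
    pderiv i ((X 0 : MvPolynomial (Fin (d + 1)) k) ^ p) = 0 := by
  rw [pderiv_pow, CharP.cast_eq_zero (MvPolynomial (Fin (d + 1)) k) p, zero_mul, zero_mul]

omit [Fact p.Prime] in
/-- … so the polar map of `Y_0^p` is zero: its kernel is everything. [folklore] -/
private theorem ker_polar_X_pow_char_eq_top' :
    LinearMap.ker (Fintype.linearCombination k fun i : Fin (d + 1) =>
      pderiv i ((X 0 : MvPolynomial (Fin (d + 1)) k) ^ p)) = ⊤ := by
  rw [eq_top_iff]
  intro w _
  rw [LinearMap.mem_ker, Fintype.linearCombination_apply]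
  simp [pderiv_X_zero_pow_char' k p]

omit [Fact p.Prime] in
/-- **Sharpness at `deg F = p`, polar side**: the polar rank of `Y_0^p` in characteristic `p` is `0` (all partials
vanish: "differential operators do not see `p`-th powers"). [cite: Hironaka1970AdditiveGroups, §2] -/
theorem finrank_span_pderiv_X_zero_pow_char :
    Module.finrank k (Submodule.span k (Set.range fun i : Fin (d + 1) =>
      pderiv i ((X 0 : MvPolynomial (Fin (d + 1)) k) ^ p))) = 0 := by
  have h : (Set.range fun i : Fin (d + 1) => pderiv i ((X 0 : MvPolynomial (Fin (d + 1)) k) ^ p)) ⊆ {0} := by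
    rintro _ ⟨i, rfl⟩
    exact pderiv_X_zero_pow_char' k p i
  have h0 : Submodule.span k (Set.range fun i : Fin (d + 1) =>
      pderiv i ((X 0 : MvPolynomial (Fin (d + 1)) k) ^ p)) = ⊥ :=
    Submodule.span_eq_bot.mpr fun x hx => h hx
  rw [h0, finrank_bot]

omit [CharP k p] in
/-- `e_0 ∉ 𝕎({Y_0^p})`: the top Hasse derivative `D_{e_0}^{(p)} Y_0^p = 1` does not vanish. [folklore] -/
private theorem single_notMem_invarianceSpace_X_pow_char' :
    (Pi.single 0 1 : Fin (d + 1) → k) ∉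
      invarianceSpace k ({(X 0 : MvPolynomial (Fin (d + 1)) k) ^ p} : Set (MvPolynomial (Fin (d + 1)) k)) := by
  have hp : p.Prime := Fact.out
  rw [mem_invarianceSpace_iff_hasseD]
  intro h
  have h1 := h _ rfl p hp.one_lt.le
  rw [hasseD_X_pow] at h1
  simp [Nat.choose_self] at h1

/-- **Sharpness of `deg F < p`**: for `F = Y_0^p` in characteristic `p` the invariance space is NOT the polar kernel
(which is all of `k^{d+1}`). [cite: Hironaka1970AdditiveGroups, §2] -/
theorem invarianceSpace_X_zero_pow_char_ne_ker_polar :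
    invarianceSpace k ({(X 0 : MvPolynomial (Fin (d + 1)) k) ^ p} : Set (MvPolynomial (Fin (d + 1)) k)) ≠
      LinearMap.ker (Fintype.linearCombination k fun i : Fin (d + 1) =>
        pderiv i ((X 0 : MvPolynomial (Fin (d + 1)) k) ^ p)) := by
  rw [ker_polar_X_pow_char_eq_top' k p]
  intro h
  exact single_notMem_invarianceSpace_X_pow_char' k p (d := d) (h ▸ Submodule.mem_top)

omit [CharP k p] in
/-- **`τ(Y_0^p) = 1`** in every characteristic (non-constant form in one variable), whereas in characteristic `p` its polar
rank is `0`: the tame equality `τ = dim ⟨∂_i F⟩` fails exactly when the degree reaches `p`.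
[cite: CossartPiltant2008, proof of Prop. 4.2] [cite: Hironaka1970AdditiveGroups, §2] -/
theorem hironakaTau_X_zero_pow_char :
    hironakaTau k ({(X 0 : MvPolynomial (Fin (d + 1)) k) ^ p} : Set (MvPolynomial (Fin (d + 1)) k)) = 1 := by
  have hp : p.Prime := Fact.out
  apply le_antisymm
  · refine (hironakaTau_le_card_vars k _).trans ?_
    calc ((X 0 : MvPolynomial (Fin (d + 1)) k) ^ p).vars.card ≤ ({0} : Finset (Fin (d + 1))).card :=
          Finset.card_le_card ((vars_pow _ _).trans (by rw [vars_X]))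
      _ = 1 := Finset.card_singleton _
  · exact one_le_hironakaTau k (Set.mem_singleton _) hp.one_lt.le (isHomogeneous_X_pow _ _)
      (pow_ne_zero _ (X_ne_zero _))

/-- In characteristic `p`, `τ(Y_0^p) ≠ dim ⟨∂_i Y_0^p⟩` (`1 ≠ 0`): the polar bound is strict at `deg F = p`.
[cite: Hironaka1970AdditiveGroups, §2] -/
theorem hironakaTau_X_zero_pow_char_ne_finrank_span_pderiv :
    hironakaTau k ({(X 0 : MvPolynomial (Fin (d + 1)) k) ^ p} : Set (MvPolynomial (Fin (d + 1)) k)) ≠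
      Module.finrank k (Submodule.span k (Set.range fun i : Fin (d + 1) =>
        pderiv i ((X 0 : MvPolynomial (Fin (d + 1)) k) ^ p))) := by
  rw [hironakaTau_X_zero_pow_char k p, finrank_span_pderiv_X_zero_pow_char k p]
  exact one_ne_zero

end Sharp

end Literature.AlgebraicGeometry.Resolution

end
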